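import Literature.Probability.FitznerVanDerHofstad2017.NobleBoundsNCoverPrime
import Literature.Probability.FitznerVanDerHofstad2017.NobleBlocksDoublePrime
import HarnessLib

/-!
# Fitzner–van der Hofstad (2017), Prop. 5.5 (5.34) from a finite cover — primed regular family, terminal family `Ā''`

[FvdH17] = R. Fitzner, R. van der Hofstad, *Mean-field behavior for nearest-neighbor percolation in `d > 10`*,
Electron. J. Probab. **22** (2017), no. 43, arXiv:1506.07977v2; Prop. 5.5 (5.34) (p. 53), §5.1 (5.4) (pp. 48–49), §6.1
proof of Lemma 5.3 "Case `a = 0, b ≥ 2`" (p. 59).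

`NobleBoundsNCoverPrime` instantiates the generic cover machinery (`nobleXiT_le_recP_chain_of_cover`,
`BlockSummation.tsum_le_vecMul_pow_dotProduct'`, `star_chain_mono`, `matAbar_starA_sec_le`) at the primed pair
`(blockBFullpt' 𝐋 X, blockBFull' 𝐋 X₂)` with the TERMINAL family fixed to the App.-B-typed `Ā' = blockAbar' 𝐋`.  This module is
the same instantiation with the terminal family `Ā'' = blockAbar'' 𝐋` of `NobleBlocksDoublePrime` (row `(0,2)` carrying the
repulsive `𝓣_{1,1̲,0}` that §6.1 derives; every other row `= Ā'`), which enters ONLY through its translation invariance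
`isTransInv_blockAbar''`.  Five theorems, the `''`-twins of the five `…'_of_cover` theorems, same hypotheses with `Ā''` in the
class estimates `h2` and in the conclusion.  No percolation estimate is proved here; nothing is cited as a fact; ADDITIVE.
-/

noncomputable section

open scoped BigOperators ENNReal Matrix

namespace Literature.Probability.FitznerVanDerHofstad2017

open _root_.MeasureTheory Literature.Probability.LatticeModels Literature.Probability.Percolation
open Literature.Probability.FitznerVanDerHofstad2017.NobleBlocks
open Literature.Probability.FitznerVanDerHofstad2017.BlockSummation
open Literature.Barriers.CriticalPhenomena

variable {d : ℕ}

section Perc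

variable (p : unitInterval)

/-- **Prop. 5.5 (5.34) at `N = n + 1` over the extended class index `Fin 3 ⊕ Unit`, FROM THE PERCOLATION
ESTIMATES, for arbitrary special families — PRIMED regular family `blockBFullpt' 𝐋 X` / `blockBFull' 𝐋 X₂`.**  Given special families `Ec Eo Eoc EA` with pointwise versions
`Ecpt Eopt Eocpt` (`Σ_{t,z} ·pt ≤ ·`) and translation invariance, a finite cover `(E, C)` of the bounding events of
`Ξ^{(n+1)}(x)` with class tuples `a : Fin (n+1) → Fin 3 ⊕ Unit`, terminal class `c : Fin 3 ⊕ Unit` (`h1`, `hC`) and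
the pointwise class estimates `h2` against `starS P^S · Π starBpt · starA Ā'' · starS P^E`, the printed-norm bound
`Σ_x Ξ^{(n+1)}(x) ≤ (P⃗^S,0) · matB(starB B Ec Eo Eoc)^n · matAbar(starA Ā'' EA) · (P⃗^E,0)` holds.
[cite: FitznerVanDerHofstad2017, Prop. 5.5 (5.34) (arXiv:1506.07977v2 p. 53); §5.1 (5.4), "Elements of the bounds" (pp. 48–49); Lemma 6.1 and §6.2.1 (pp. 65–67); §6.1 (6.4)–(6.5) (p. 58)] -/
theorem tsum_nobleXiT_le_star'_of_cover'' (n : ℕ)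
    (X : DirBlockFamilyPt d) (X₂ : DirBlockFamily d)
    (hXsum : ∀ κ a a' u w w' u', ∑' t, ∑' z, X κ a a' u w t z w' u' = X₂ κ a a' u w w' u')
    (hX₂ti : ∀ ι a b, IsTransInv (X₂ ι a b))
    (Ec : Fin d × Bool → Fin 3 → Site d → Site d → Site d → ℝ≥0∞)
    (Eo : Fin d × Bool → Fin 3 → Site d → Site d → Site d → Site d → ℝ≥0∞)
    (Eoc : Fin d × Bool → Site d → Site d → Site d → ℝ≥0∞)
    (EA : Fin d × Bool → Fin 3 → Site d → Site d → Site d → ℝ≥0∞)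
    (Ecpt : Fin d × Bool → Fin 3 → Site d → Site d → Site d → Site d → Site d → ℝ≥0∞)
    (Eopt : Fin d × Bool → Fin 3 → Site d → Site d → Site d → Site d → Site d → Site d → ℝ≥0∞)
    (Eocpt : Fin d × Bool → Site d → Site d → Site d → Site d → Site d → ℝ≥0∞)
    (hEcpt : ∀ κ a u w u', ∑' t, ∑' z, Ecpt κ a u w t z u' ≤ Ec κ a u w u')
    (hEopt : ∀ κ a' u w w' u', ∑' t, ∑' z, Eopt κ a' u w t z w' u' ≤ Eo κ a' u w w' u')
    (hEocpt : ∀ κ u w u', ∑' t, ∑' z, Eocpt κ u w t z u' ≤ Eoc κ u w u')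
    (hEc : ∀ κ a, IsTransInv₃ (Ec κ a)) (hEo : ∀ κ a', IsTransInv (Eo κ a')) (hEoc : ∀ κ, IsTransInv₃ (Eoc κ))
    (hEA : ∀ κ c, IsTransInv₃ (EA κ c))
    (E : Site d → (Fin (n + 1) → Site d × Site d) → (Fin (n + 1) → Site d) → (Fin (n + 1) → Site d) →
      (Fin (n + 1) → Site d) → Set (Fin (n + 2) → BondConfig (Site d)))
    (C : Site d → (Fin (n + 1) → Site d × Site d) → (Fin (n + 1) → Site d) → (Fin (n + 1) → Site d) →
      (Fin (n + 1) → Site d) → (Fin (n + 1) → Fin 3 ⊕ Unit) → Fin 3 ⊕ Unit → Set (Fin (n + 2) → BondConfig (Site d)))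
    (hC : ∀ x b w t z, E x b w t z ⊆ ⋃ a, ⋃ c, C x b w t z a c)
    (h1 : ∀ x, nobleXiT d p (n + 1) x ≤ ∑' b : Fin (n + 1) → Site d × Site d, ∑' w : Fin (n + 1) → Site d,
      ∑' t : Fin (n + 1) → Site d, ∑' z : Fin (n + 1) → Site d,
        (∏ i, ENNReal.ofReal (bondJ d p ((b i).2 - (b i).1))) * piPerc d p (n + 2) (E x b w t z))
    (h2 : ∀ x (a : Fin (n + 1) → Fin 3 ⊕ Unit) (c : Fin 3 ⊕ Unit) (b : Fin (n + 1) → Site d × Site d)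
      (w t z : Fin (n + 1) → Site d),
      (∏ i, ENNReal.ofReal (bondJ d p ((b i).2 - (b i).1))) * piPerc d p (n + 2) (E x b w t z ∩ C x b w t z a c) ≤
        ∑ κ : Fin (n + 1) → Fin d × Bool, dirInd stepVec κ b *
          (starS (blockPS (Letters.perc d p)) (a 0) (b 0).1 (w 0) *
            chainTail (starBpt (blockBFullpt' (Letters.perc d p) X) Ecpt Eopt Eocpt) (starA (blockAbar'' (Letters.perc d p)) EA) (starS (blockPE (Letters.perc d p)))
              x n κ a c b w t z)) :
    ∑' x, nobleXiT d p (n + 1) x ≤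
      vecP (starS (blockPS (Letters.perc d p))) ᵥ* matB (starB (blockBFull' (Letters.perc d p) X₂) Ec Eo Eoc) ^ n ᵥ* matAbar (starA (blockAbar'' (Letters.perc d p)) EA)
        ⬝ᵥ vecP (starS (blockPE (Letters.perc d p))) :=
  tsum_le_vecMul_pow_dotProduct' (isTransInv_starB (isTransInv_blockBFull' (Letters.perc d p) hX₂ti) hEc hEo hEoc)
    (isTransInv_starA (isTransInv_blockAbar'' (Letters.perc d p)) hEA) (fun x => nobleXiT d p (n + 1) x) (starS (blockPS (Letters.perc d p)))
    (starS (blockPE (Letters.perc d p))) n fun x =>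
    nobleXiT_le_recP_chain_of_cover p x n (starS (blockPS (Letters.perc d p))) (starB (blockBFull' (Letters.perc d p) X₂) Ec Eo Eoc)
      (starBpt (blockBFullpt' (Letters.perc d p) X) Ecpt Eopt Eocpt) (starBpt_hBpt _ _ _ _ (blockBFullpt'_hBpt (Letters.perc d p) X X₂ hXsum) hEcpt hEopt hEocpt)
      (starA (blockAbar'' (Letters.perc d p)) EA) (starS (blockPE (Letters.perc d p))) (E x) (C x) (hC x) (h1 x) (h2 x)


/-- **(5.34) at `N = n + 1` over `Fin 3 ⊕ Unit` under the SECTION choice** (pinned special block = the `z = w`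
section of `blockBFullpt' 𝐋 X` with entry class `2`, closed = the exit-class-`0`, `w' = u'` section, pinned terminal
= the `z = w` section of the row `2` of `blockAbar'' 𝐋`): from the cover and the pointwise class estimates against
`secStarBpt (blockBFullpt' 𝐋 X) 2 0` and `starA (blockAbar'' 𝐋) (secEA (blockAbar'' 𝐋) 2)`.
[cite: FitznerVanDerHofstad2017, Prop. 5.5 (5.34) (arXiv:1506.07977v2 p. 53); §5.1 (5.4) (p. 48); Lemma 6.1 and §6.2.1 (pp. 65–67)] -/
theorem tsum_nobleXiT_le_secStar'_of_cover'' (n : ℕ)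
    (X : DirBlockFamilyPt d) (X₂ : DirBlockFamily d)
    (hXsum : ∀ κ a a' u w w' u', ∑' t, ∑' z, X κ a a' u w t z w' u' = X₂ κ a a' u w w' u')
    (hX₂ti : ∀ ι a b, IsTransInv (X₂ ι a b))
    (hXti : ∀ κ a a', IsTransInv₆ (X κ a a'))
    (E : Site d → (Fin (n + 1) → Site d × Site d) → (Fin (n + 1) → Site d) → (Fin (n + 1) → Site d) →
      (Fin (n + 1) → Site d) → Set (Fin (n + 2) → BondConfig (Site d)))
    (C : Site d → (Fin (n + 1) → Site d × Site d) → (Fin (n + 1) → Site d) → (Fin (n + 1) → Site d) →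
      (Fin (n + 1) → Site d) → (Fin (n + 1) → Fin 3 ⊕ Unit) → Fin 3 ⊕ Unit → Set (Fin (n + 2) → BondConfig (Site d)))
    (hC : ∀ x b w t z, E x b w t z ⊆ ⋃ a, ⋃ c, C x b w t z a c)
    (h1 : ∀ x, nobleXiT d p (n + 1) x ≤ ∑' b : Fin (n + 1) → Site d × Site d, ∑' w : Fin (n + 1) → Site d,
      ∑' t : Fin (n + 1) → Site d, ∑' z : Fin (n + 1) → Site d,
        (∏ i, ENNReal.ofReal (bondJ d p ((b i).2 - (b i).1))) * piPerc d p (n + 2) (E x b w t z))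
    (h2 : ∀ x (a : Fin (n + 1) → Fin 3 ⊕ Unit) (c : Fin 3 ⊕ Unit) (b : Fin (n + 1) → Site d × Site d)
      (w t z : Fin (n + 1) → Site d),
      (∏ i, ENNReal.ofReal (bondJ d p ((b i).2 - (b i).1))) * piPerc d p (n + 2) (E x b w t z ∩ C x b w t z a c) ≤
        ∑ κ : Fin (n + 1) → Fin d × Bool, dirInd stepVec κ b *
          (starS (blockPS (Letters.perc d p)) (a 0) (b 0).1 (w 0) *
            chainTail (secStarBpt (blockBFullpt' (Letters.perc d p) X) 2 0) (starA (blockAbar'' (Letters.perc d p)) (secEA (blockAbar'' (Letters.perc d p)) 2))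
              (starS (blockPE (Letters.perc d p))) x n κ a c b w t z)) :
    ∑' x, nobleXiT d p (n + 1) x ≤
      vecP (starS (blockPS (Letters.perc d p))) ᵥ*
        matB (starB (blockBFull' (Letters.perc d p) X₂) (secEc (blockBFullpt' (Letters.perc d p) X) 0)
          (secEo (blockBFullpt' (Letters.perc d p) X) 2) (secEoc (blockBFullpt' (Letters.perc d p) X) 2 0)) ^ n ᵥ*
          matAbar (starA (blockAbar'' (Letters.perc d p)) (secEA (blockAbar'' (Letters.perc d p)) 2)) ⬝ᵥ vecP (starS (blockPE (Letters.perc d p))) :=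
  tsum_nobleXiT_le_star'_of_cover'' p n X X₂ hXsum hX₂ti _ _ _ _ (secEcpt (blockBFullpt' (Letters.perc d p) X) 0) (secEopt (blockBFullpt' (Letters.perc d p) X) 2)
    (secEocpt (blockBFullpt' (Letters.perc d p) X) 2 0) (fun κ a u w u' => (tsum_tsum_secEcpt (blockBFullpt' (Letters.perc d p) X) 0 κ a u w u').le)
    (fun κ a' u w w' u' => (tsum_tsum_secEopt (blockBFullpt' (Letters.perc d p) X) 2 κ a' u w w' u').le)
    (fun κ u w u' => (tsum_tsum_secEocpt (blockBFullpt' (Letters.perc d p) X) 2 0 κ u w u').le)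
    (isTransInv₃_secEc (isTransInv₆_blockBFullpt' (Letters.perc d p) hXti) 0) (isTransInv_secEo (isTransInv₆_blockBFullpt' (Letters.perc d p) hXti) 2)
    (isTransInv₃_secEoc (isTransInv₆_blockBFullpt' (Letters.perc d p) hXti) 2 0) (isTransInv₃_secEA (isTransInv_blockAbar'' (Letters.perc d p)) 2)
    E C hC h1 h2


/-- **The size model as a kernel inequality**: under the section estimates, `Σ_x Ξ^{(n+1)}(x)` is bounded by the
PRINTED matrices bordered with their row `2` and column `0`:
`(P⃗^S,0) · [[B, B_{·,0}],[B_{2,·}, B_{2,0}]]^n · [[Ā'',0],[Ā''_{2,·},0]] · (P⃗^E,0)` (`B = matB (blockBFull' 𝐋 X₂)`,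
`Ā'' = matAbar (blockAbar'' 𝐋) = matAbarIota'' 𝐋`).
[cite: FitznerVanDerHofstad2017, Prop. 5.5 (5.34) (arXiv:1506.07977v2 p. 53); §5.1 "Elements of the bounds" (p. 49); Lemma 6.1 and §6.2.1 (pp. 65–67)] -/
theorem tsum_nobleXiT_le_bordered'_of_cover'' (n : ℕ)
    (X : DirBlockFamilyPt d) (X₂ : DirBlockFamily d)
    (hXsum : ∀ κ a a' u w w' u', ∑' t, ∑' z, X κ a a' u w t z w' u' = X₂ κ a a' u w w' u')
    (hX₂ti : ∀ ι a b, IsTransInv (X₂ ι a b))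
    (hXti : ∀ κ a a', IsTransInv₆ (X κ a a'))
    (E : Site d → (Fin (n + 1) → Site d × Site d) → (Fin (n + 1) → Site d) → (Fin (n + 1) → Site d) →
      (Fin (n + 1) → Site d) → Set (Fin (n + 2) → BondConfig (Site d)))
    (C : Site d → (Fin (n + 1) → Site d × Site d) → (Fin (n + 1) → Site d) → (Fin (n + 1) → Site d) →
      (Fin (n + 1) → Site d) → (Fin (n + 1) → Fin 3 ⊕ Unit) → Fin 3 ⊕ Unit → Set (Fin (n + 2) → BondConfig (Site d)))
    (hC : ∀ x b w t z, E x b w t z ⊆ ⋃ a, ⋃ c, C x b w t z a c)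
    (h1 : ∀ x, nobleXiT d p (n + 1) x ≤ ∑' b : Fin (n + 1) → Site d × Site d, ∑' w : Fin (n + 1) → Site d,
      ∑' t : Fin (n + 1) → Site d, ∑' z : Fin (n + 1) → Site d,
        (∏ i, ENNReal.ofReal (bondJ d p ((b i).2 - (b i).1))) * piPerc d p (n + 2) (E x b w t z))
    (h2 : ∀ x (a : Fin (n + 1) → Fin 3 ⊕ Unit) (c : Fin 3 ⊕ Unit) (b : Fin (n + 1) → Site d × Site d)
      (w t z : Fin (n + 1) → Site d),
      (∏ i, ENNReal.ofReal (bondJ d p ((b i).2 - (b i).1))) * piPerc d p (n + 2) (E x b w t z ∩ C x b w t z a c) ≤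
        ∑ κ : Fin (n + 1) → Fin d × Bool, dirInd stepVec κ b *
          (starS (blockPS (Letters.perc d p)) (a 0) (b 0).1 (w 0) *
            chainTail (secStarBpt (blockBFullpt' (Letters.perc d p) X) 2 0) (starA (blockAbar'' (Letters.perc d p)) (secEA (blockAbar'' (Letters.perc d p)) 2))
              (starS (blockPE (Letters.perc d p))) x n κ a c b w t z)) :
    ∑' x, nobleXiT d p (n + 1) x ≤
      Sum.elim (vecPS (Letters.perc d p)) (0 : Unit → ℝ≥0∞) ᵥ*
        Matrix.fromBlocks (matB (blockBFull' (Letters.perc d p) X₂)) (Matrix.of fun (a : Fin 3) (_ : Unit) => matB (blockBFull' (Letters.perc d p) X₂) a 0)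
          (Matrix.of fun (_ : Unit) (a' : Fin 3) => matB (blockBFull' (Letters.perc d p) X₂) 2 a')
          (Matrix.of fun (_ : Unit) (_ : Unit) => matB (blockBFull' (Letters.perc d p) X₂) 2 0) ^ n ᵥ*
        Matrix.fromBlocks (matAbar (blockAbar'' (Letters.perc d p))) (0 : Matrix (Fin 3) Unit ℝ≥0∞)
          (Matrix.of fun (_ : Unit) (c : Fin 3) => matAbar (blockAbar'' (Letters.perc d p)) 2 c) (0 : Matrix Unit Unit ℝ≥0∞) ⬝ᵥ
          Sum.elim (vecPE (Letters.perc d p)) (0 : Unit → ℝ≥0∞) := by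
  refine (tsum_nobleXiT_le_secStar'_of_cover'' p n X X₂ hXsum hX₂ti hXti E C hC h1 h2).trans ?_
  rw [vecP_starS, vecP_starS]
  exact star_chain_mono (fun i => le_rfl) (matB_starB_sec_le (blockBFullpt'_hBpt (Letters.perc d p) X X₂ hXsum) 2 0)
    (matAbar_starA_sec_le (blockAbar'' (Letters.perc d p)) 2) (fun i => le_rfl) n


/-- **(5.34) at `N = n + 1` over `Fin 3 ⊕ Unit` under the SECTION choice** (pinned special block = the `z = w`
section of `blockBFullpt' 𝐋 0` with entry class `2`, closed = the exit-class-`0`, `w' = u'` section, pinned terminal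
= the `z = w` section of the row `2` of `blockAbar'' 𝐋`): from the cover and the pointwise class estimates against
`secStarBpt (blockBFullpt' 𝐋 0) 2 0` and `starA (blockAbar'' 𝐋) (secEA (blockAbar'' 𝐋) 2)`.
[cite: FitznerVanDerHofstad2017, Prop. 5.5 (5.34) (arXiv:1506.07977v2 p. 53); §5.1 (5.4) (p. 48); Lemma 6.1 and §6.2.1 (pp. 65–67)] -/
theorem tsum_nobleXiT_le_secStar'_zero_of_cover'' (n : ℕ)
    (E : Site d → (Fin (n + 1) → Site d × Site d) → (Fin (n + 1) → Site d) → (Fin (n + 1) → Site d) →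
      (Fin (n + 1) → Site d) → Set (Fin (n + 2) → BondConfig (Site d)))
    (C : Site d → (Fin (n + 1) → Site d × Site d) → (Fin (n + 1) → Site d) → (Fin (n + 1) → Site d) →
      (Fin (n + 1) → Site d) → (Fin (n + 1) → Fin 3 ⊕ Unit) → Fin 3 ⊕ Unit → Set (Fin (n + 2) → BondConfig (Site d)))
    (hC : ∀ x b w t z, E x b w t z ⊆ ⋃ a, ⋃ c, C x b w t z a c)
    (h1 : ∀ x, nobleXiT d p (n + 1) x ≤ ∑' b : Fin (n + 1) → Site d × Site d, ∑' w : Fin (n + 1) → Site d,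
      ∑' t : Fin (n + 1) → Site d, ∑' z : Fin (n + 1) → Site d,
        (∏ i, ENNReal.ofReal (bondJ d p ((b i).2 - (b i).1))) * piPerc d p (n + 2) (E x b w t z))
    (h2 : ∀ x (a : Fin (n + 1) → Fin 3 ⊕ Unit) (c : Fin 3 ⊕ Unit) (b : Fin (n + 1) → Site d × Site d)
      (w t z : Fin (n + 1) → Site d),
      (∏ i, ENNReal.ofReal (bondJ d p ((b i).2 - (b i).1))) * piPerc d p (n + 2) (E x b w t z ∩ C x b w t z a c) ≤
        ∑ κ : Fin (n + 1) → Fin d × Bool, dirInd stepVec κ b *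
          (starS (blockPS (Letters.perc d p)) (a 0) (b 0).1 (w 0) *
            chainTail (secStarBpt (blockBFullpt' (Letters.perc d p) 0) 2 0) (starA (blockAbar'' (Letters.perc d p)) (secEA (blockAbar'' (Letters.perc d p)) 2))
              (starS (blockPE (Letters.perc d p))) x n κ a c b w t z)) :
    ∑' x, nobleXiT d p (n + 1) x ≤
      vecP (starS (blockPS (Letters.perc d p))) ᵥ*
        matB (starB (blockBFull' (Letters.perc d p) 0) (secEc (blockBFullpt' (Letters.perc d p) 0) 0)
          (secEo (blockBFullpt' (Letters.perc d p) 0) 2) (secEoc (blockBFullpt' (Letters.perc d p) 0) 2 0)) ^ n ᵥ*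
          matAbar (starA (blockAbar'' (Letters.perc d p)) (secEA (blockAbar'' (Letters.perc d p)) 2)) ⬝ᵥ vecP (starS (blockPE (Letters.perc d p))) :=
  tsum_nobleXiT_le_secStar'_of_cover'' p n 0 0 (fun _ _ _ _ _ _ _ => by simp) (fun _ _ _ _ _ _ _ _ => rfl)
    isTransInv₆_zero_familyPt E C hC h1 h2

/-- **The size model as a kernel inequality**: under the section estimates, `Σ_x Ξ^{(n+1)}(x)` is bounded by the
PRINTED matrices bordered with their row `2` and column `0`:
`(P⃗^S,0) · [[B, B_{·,0}],[B_{2,·}, B_{2,0}]]^n · [[Ā'',0],[Ā''_{2,·},0]] · (P⃗^E,0)` (`B = matB (blockBFull' 𝐋 0)`,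
`Ā'' = matAbar (blockAbar'' 𝐋) = matAbarIota'' 𝐋`).
[cite: FitznerVanDerHofstad2017, Prop. 5.5 (5.34) (arXiv:1506.07977v2 p. 53); §5.1 "Elements of the bounds" (p. 49); Lemma 6.1 and §6.2.1 (pp. 65–67)] -/
theorem tsum_nobleXiT_le_bordered'_zero_of_cover'' (n : ℕ)
    (E : Site d → (Fin (n + 1) → Site d × Site d) → (Fin (n + 1) → Site d) → (Fin (n + 1) → Site d) →
      (Fin (n + 1) → Site d) → Set (Fin (n + 2) → BondConfig (Site d)))
    (C : Site d → (Fin (n + 1) → Site d × Site d) → (Fin (n + 1) → Site d) → (Fin (n + 1) → Site d) →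
      (Fin (n + 1) → Site d) → (Fin (n + 1) → Fin 3 ⊕ Unit) → Fin 3 ⊕ Unit → Set (Fin (n + 2) → BondConfig (Site d)))
    (hC : ∀ x b w t z, E x b w t z ⊆ ⋃ a, ⋃ c, C x b w t z a c)
    (h1 : ∀ x, nobleXiT d p (n + 1) x ≤ ∑' b : Fin (n + 1) → Site d × Site d, ∑' w : Fin (n + 1) → Site d,
      ∑' t : Fin (n + 1) → Site d, ∑' z : Fin (n + 1) → Site d,
        (∏ i, ENNReal.ofReal (bondJ d p ((b i).2 - (b i).1))) * piPerc d p (n + 2) (E x b w t z))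
    (h2 : ∀ x (a : Fin (n + 1) → Fin 3 ⊕ Unit) (c : Fin 3 ⊕ Unit) (b : Fin (n + 1) → Site d × Site d)
      (w t z : Fin (n + 1) → Site d),
      (∏ i, ENNReal.ofReal (bondJ d p ((b i).2 - (b i).1))) * piPerc d p (n + 2) (E x b w t z ∩ C x b w t z a c) ≤
        ∑ κ : Fin (n + 1) → Fin d × Bool, dirInd stepVec κ b *
          (starS (blockPS (Letters.perc d p)) (a 0) (b 0).1 (w 0) *
            chainTail (secStarBpt (blockBFullpt' (Letters.perc d p) 0) 2 0) (starA (blockAbar'' (Letters.perc d p)) (secEA (blockAbar'' (Letters.perc d p)) 2))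
              (starS (blockPE (Letters.perc d p))) x n κ a c b w t z)) :
    ∑' x, nobleXiT d p (n + 1) x ≤
      Sum.elim (vecPS (Letters.perc d p)) (0 : Unit → ℝ≥0∞) ᵥ*
        Matrix.fromBlocks (matB (blockBFull' (Letters.perc d p) 0)) (Matrix.of fun (a : Fin 3) (_ : Unit) => matB (blockBFull' (Letters.perc d p) 0) a 0)
          (Matrix.of fun (_ : Unit) (a' : Fin 3) => matB (blockBFull' (Letters.perc d p) 0) 2 a')
          (Matrix.of fun (_ : Unit) (_ : Unit) => matB (blockBFull' (Letters.perc d p) 0) 2 0) ^ n ᵥ*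
        Matrix.fromBlocks (matAbar (blockAbar'' (Letters.perc d p))) (0 : Matrix (Fin 3) Unit ℝ≥0∞)
          (Matrix.of fun (_ : Unit) (c : Fin 3) => matAbar (blockAbar'' (Letters.perc d p)) 2 c) (0 : Matrix Unit Unit ℝ≥0∞) ⬝ᵥ
          Sum.elim (vecPE (Letters.perc d p)) (0 : Unit → ℝ≥0∞) :=
  tsum_nobleXiT_le_bordered'_of_cover'' p n 0 0 (fun _ _ _ _ _ _ _ => by simp) (fun _ _ _ _ _ _ _ _ => rfl)
    isTransInv₆_zero_familyPt E C hC h1 h2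

end Perc

end Literature.Probability.FitznerVanDerHofstad2017

end
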